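import Literature.AlgebraicGeometry.Motives.HodgeThetaAnnihilatorTimesGluedBlocks
import Literature.AlgebraicGeometry.Motives.HodgeLieBlockSummandSurjective
import Literature.AlgebraicGeometry.Motives.HodgeLieSemisimpleTimesAbelian
import HarnessLib

/-!
# `𝔥(H₁ ⊕ H₂) = 𝔥(H₁) × 𝔥(H₂)` when the admissible algebras of `H₂` are GLUED `𝔰𝔩₂`-BLOCKS and `Hom_Hdg(H₂, H₁) = 0`
# (Moonen–Zarhin 1999 Lemma (3.4) with (2.2), for the Lie algebra `hodgeLie` itself: `Hg(X₁ × X₂) = Hg(X₁) × Hg(X₂)` for `X₂` with real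
# multiplication of relative dimension one or quaternionic multiplication of minimal dimension, `X₁` ARBITRARY)

Family `hodge`, layer `Literature/AlgebraicGeometry/Motives`; THEOREMS ONLY (no definition, no named fact).  Written for the cell
`pub-hodgecm2` (COR-CM), seat `b27` gen 47 (count-neutral Mumford–Tate-rank ladder); companion of `Motives/HodgeLieTimesNonCMCurve`
(rank-`2` generic summand) and `Motives/HodgeLieTimesLowRankGeneric` (generic summand of rank `2`, `4`, `6`).
The tree's `HodgeThetaAnnihilatorTimesGluedBlocks` (cell `pub-hodge-ring2`) proves Moonen–Zarhin's Lemma (3.4) for a second factor whose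
admissible algebras are glued `𝔰𝔩₂`-blocks — «`Hg(X₁ × X₂) = Hg(X₁) × Hg(X₂)` or `Hom(X₂, X₁) ≠ 0`» — as the abstract statement
`goursat_incl_corner_mem_of_hom_eq_zero_of_glued` about ANY bracket-closed rational `𝔞 ⊆ End(V₁ ⊕ V₂)` commuting with the two
projectors, with `ψ_i`-skew corners (the second commuting with `End_Hdg(H₂)`) and `Θ ∈ 𝔞_ℂ`, under the block data (GLUED), (BLOCKS),
(QS) on `V₂ ⊗ ℂ` (verbatim the output of the tree's bridges `exists_glued_adapted_blockBasis_of_isMurtyTypeWith_one`,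
`exists_glued_adapted_blockBasis_of_realSplitting`).  HERE it is applied to `𝔞 = 𝔥(H)`, the Lie algebra of the Hodge group:

* §1 (no block data) **`exists_linearEquiv_prod_hodgeLie_of_corner_mem`** — for `H ≅ H₁ ⊕ H₂` (morphisms `ι_i`, `π_i` with
  `π_i ι_i = id`, `ι₁ π₁ + ι₂ π₂ = id`): if `𝔥(H)` contains the first corner `ι₁ (π₁ X ι₁) π₁` of each of its elements, then
  `(Y₁, Y₂) ↦ ι₁ Y₁ π₁ + ι₂ Y₂ π₂` is a linear isomorphism `𝔥(H₁) × 𝔥(H₂) ≅ 𝔥(H)` («`Hg(X₁ × X₂) = Hg(X₁) × Hg(X₂)`»: the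
  projections are onto by `comp_mem_hodgeLie_of_block`, `Motives/HodgeLieBlockSummandSurjective`);
* §2 **`corner_mem_and_finrank_hodgeLie_eq_add_of_gluedBlocks_summand`** — for effective weight-one polarizable `H₁`, `H₂` with
  glued-block data on `V₂ ⊗ ℂ` and no non-zero `ℚ`-linear `V₂ → V₁` respecting the Hodge pieces: `𝔥(H)` contains the first corners
  of its elements AND `dim_ℚ 𝔥(H) = dim_ℚ 𝔥(H₁) + dim_ℚ 𝔥(H₂)`.
No hypothesis on `H₁` (`X₁` ARBITRARY).  AV reading: `CorCM/MumfordTateRankTimesRealMultiplication` (`t(A × S) + 1 = t(A) + t(S)` for `S`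
of Murty type with `m = 1` — e.g. a simple abelian surface with real multiplication — and `Hom(A, S) = 0`).

## References
* [MoonenZarhin1999LowDim] B. Moonen, Yu. G. Zarhin, *Hodge classes on abelian varieties of low dimension*, Math. Ann. 315 (1999),
  §2 (2.2), §3 (3.1), Lemma (3.3), Lemma (3.4), §5 (5.4)–(5.5) [corpus: paper:arxiv-math_9901113 pp. 5–7, 9].
  [cite: MoonenZarhin1999LowDim, §3 Lemma (3.4)]
* [Hazama1983] F. Hazama, Tôhoku Math. J. 35 (1983), §3 pp. 305–306. [cite: Hazama1983, §3 (pp. 305–306)]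
* [Murty1988] V. Kumar Murty, Proc. AMS 104 (1988), Thm. 2 (p. 67). [cite: Murty1988, Thm. 2 (p. 67)]
* [Deligne1982HodgeCycles] P. Deligne, LNM 900 (1982), I §3.1 and Prop. 3.4. [cite: Deligne1982HodgeCycles, I §3.1 and Prop. 3.4]
-/

noncomputable section

open scoped TensorProduct

namespace Literature.AlgebraicGeometry.Motives

namespace HodgeStructure

open RealPlaces

universe u

variable {V₁ : Type u} [AddCommGroup V₁] [Module ℚ V₁] [Module.Finite ℚ V₁]
  {V₂ : Type u} [AddCommGroup V₂] [Module ℚ V₂] [Module.Finite ℚ V₂]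
  {V : Type u} [AddCommGroup V] [Module ℚ V] [Module.Finite ℚ V] [HodgeTensorFacts.{u, u}] {n : ℤ}
  {H₁ : HodgeStructure V₁ n} {H₂ : HodgeStructure V₂ n} {H : HodgeStructure V n}
  (ι₁ : Hom H₁ H) (π₁ : Hom H H₁) (ι₂ : Hom H₂ H) (π₂ : Hom H H₂)
  (hπι₁ : ∀ v, π₁.toLinearMap (ι₁.toLinearMap v) = v) (hπι₂ : ∀ v, π₂.toLinearMap (ι₂.toLinearMap v) = v)
  (hsum : ∀ v, ι₁.toLinearMap (π₁.toLinearMap v) + ι₂.toLinearMap (π₂.toLinearMap v) = v)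

omit [Module.Finite ℚ V₁] [Module.Finite ℚ V₂] [Module.Finite ℚ V] [HodgeTensorFacts.{u, u}] in
include hπι₁ hπι₂ hsum in
/-- `π₂ ι₁ = 0` for a decomposition `ι₁ π₁ + ι₂ π₂ = id` with `π_i ι_i = id`. [folklore] -/
private theorem proj₂_incl₁_eq_zero'' (v : V₁) : π₂.toLinearMap (ι₁.toLinearMap v) = 0 := by
  have h := congrArg π₂.toLinearMap (hsum (ι₁.toLinearMap v))
  rw [map_add, hπι₁ v, hπι₂] at h
  exact add_eq_left.1 h

omit [Module.Finite ℚ V₁] [Module.Finite ℚ V₂] [Module.Finite ℚ V] [HodgeTensorFacts.{u, u}] in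
include hπι₁ hπι₂ hsum in
/-- `π₁ ι₂ = 0` for a decomposition `ι₁ π₁ + ι₂ π₂ = id` with `π_i ι_i = id`. [folklore] -/
private theorem proj₁_incl₂_eq_zero'' (v : V₂) : π₁.toLinearMap (ι₂.toLinearMap v) = 0 := by
  have h := congrArg π₁.toLinearMap (hsum (ι₂.toLinearMap v))
  rw [map_add, hπι₂ v, hπι₁] at h
  exact add_eq_left.1 h

/-! ## §1 Corner membership splits `𝔥(H)` as `𝔥(H₁) × 𝔥(H₂)` -/

section Corner

variable (hcorner : ∀ X ∈ H.hodgeLie,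
    ι₁.toLinearMap ∘ₗ (π₁.toLinearMap ∘ₗ X ∘ₗ ι₁.toLinearMap) ∘ₗ π₁.toLinearMap ∈ H.hodgeLie)

include hπι₁ hπι₂ hsum hcorner in
/-- **`𝔥(H) = ι₁ 𝔥(H₁) π₁ ⊕ ι₂ 𝔥(H₂) π₂` when `𝔥(H)` contains the first corners of its elements:** `X ∈ 𝔥(H)` iff
`X = ι₁ Y₁ π₁ + ι₂ Y₂ π₂` with `Y_i ∈ 𝔥(H_i)` (`⟹`: the diagonal blocks `π_i X ι_i ∈ 𝔥(H_i)`, `comp_mem_hodgeLie_of_retract`, and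
`X` is the sum of its diagonal blocks, `eq_sum_blocks_of_mem_hodgeLie`; `⟸`: `𝔥(H)` is block diagonal for `e₁ = ι₁ π₁` and for
`e₂ = ι₂ π₂ = 1 - e₁`, so both `𝔥(H_i)` extend by zero, `comp_mem_hodgeLie_of_block`).
[cite: MoonenZarhin1999LowDim, §3 (3.1) and Lemma (3.4)] [cite: Deligne1982HodgeCycles, I §3.1 and Prop. 3.4] -/
private theorem mem_hodgeLie_iff_of_corner_mem (X : Module.End ℚ V) :
    X ∈ H.hodgeLie ↔ ∃ Y₁ ∈ H₁.hodgeLie, ∃ Y₂ ∈ H₂.hodgeLie,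
      X = ι₁.toLinearMap ∘ₗ Y₁ ∘ₗ π₁.toLinearMap + ι₂.toLinearMap ∘ₗ Y₂ ∘ₗ π₂.toLinearMap := by
  -- block diagonality in the forms `e₁ X ∈ 𝔥(H)` and `e₂ X ∈ 𝔥(H)`
  have heq₁ : ∀ X ∈ H.hodgeLie, (ι₁.toLinearMap ∘ₗ π₁.toLinearMap) ∘ₗ X =
      ι₁.toLinearMap ∘ₗ (π₁.toLinearMap ∘ₗ X ∘ₗ ι₁.toLinearMap) ∘ₗ π₁.toLinearMap := by
    intro X hX
    have h := eq_sum_blocks_of_mem_hodgeLie ι₁ π₁ ι₂ π₂ hπι₁ hπι₂ hsum hX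
    refine LinearMap.ext fun v => ?_
    conv_lhs => rw [h]
    simp only [LinearMap.comp_apply, LinearMap.add_apply, map_add, hπι₁,
      proj₁_incl₂_eq_zero'' ι₁ π₁ ι₂ π₂ hπι₁ hπι₂ hsum, map_zero, add_zero]
  have hblock₁ : ∀ X ∈ H.hodgeLie, (ι₁.toLinearMap ∘ₗ π₁.toLinearMap) ∘ₗ X ∈ H.hodgeLie := by
    intro X hX
    rw [heq₁ X hX]
    exact hcorner X hX
  have hblock₂ : ∀ X ∈ H.hodgeLie, (ι₂.toLinearMap ∘ₗ π₂.toLinearMap) ∘ₗ X ∈ H.hodgeLie := by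
    intro X hX
    have he : (ι₂.toLinearMap ∘ₗ π₂.toLinearMap) ∘ₗ X = X - (ι₁.toLinearMap ∘ₗ π₁.toLinearMap) ∘ₗ X := by
      refine LinearMap.ext fun v => ?_
      rw [LinearMap.sub_apply, LinearMap.comp_apply, LinearMap.comp_apply, LinearMap.comp_apply, LinearMap.comp_apply,
        eq_sub_iff_add_eq, add_comm]
      exact hsum (X v)
    rw [he]
    exact Submodule.sub_mem _ hX (hblock₁ X hX)
  constructor
  · intro hX
    exact ⟨_, comp_mem_hodgeLie_of_retract ι₁ π₁ hπι₁ hX, _, comp_mem_hodgeLie_of_retract ι₂ π₂ hπι₂ hX,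
      eq_sum_blocks_of_mem_hodgeLie ι₁ π₁ ι₂ π₂ hπι₁ hπι₂ hsum hX⟩
  · rintro ⟨Y₁, hY₁, Y₂, hY₂, rfl⟩
    exact Submodule.add_mem _ (comp_mem_hodgeLie_of_block ι₁ π₁ hπι₁ hblock₁ hY₁)
      (comp_mem_hodgeLie_of_block ι₂ π₂ hπι₂ hblock₂ hY₂)

include hπι₁ hπι₂ hsum hcorner in
/-- **`𝔥(H₁) × 𝔥(H₂) ≅ 𝔥(H)` by `(Y₁, Y₂) ↦ ι₁ Y₁ π₁ + ι₂ Y₂ π₂` when `𝔥(H)` contains the first corners of its elements** — the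
Lie-algebra form of «`Hg(X₁ × X₂) = Hg(X₁) × Hg(X₂)`» (Moonen–Zarhin (3.1)): the block map is injective (`π_i (⋯) ι_i` recovers `Y_i`)
and onto (`mem_hodgeLie_iff_of_corner_mem`). [cite: MoonenZarhin1999LowDim, §3 (3.1) and Lemma (3.4)]
[cite: Deligne1982HodgeCycles, I §3.1 and Prop. 3.4] -/
theorem exists_linearEquiv_prod_hodgeLie_of_corner_mem :
    ∃ Φ : (H₁.hodgeLie × H₂.hodgeLie) ≃ₗ[ℚ] H.hodgeLie, ∀ Y : H₁.hodgeLie × H₂.hodgeLie,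
      ((Φ Y : H.hodgeLie) : Module.End ℚ V) =
        ι₁.toLinearMap ∘ₗ (Y.1 : Module.End ℚ V₁) ∘ₗ π₁.toLinearMap + ι₂.toLinearMap ∘ₗ (Y.2 : Module.End ℚ V₂) ∘ₗ π₂.toLinearMap := by
  have hiff := mem_hodgeLie_iff_of_corner_mem ι₁ π₁ ι₂ π₂ hπι₁ hπι₂ hsum hcorner
  let Φ : (H₁.hodgeLie × H₂.hodgeLie) →ₗ[ℚ] H.hodgeLie :=
    { toFun := fun Y => ⟨ι₁.toLinearMap ∘ₗ (Y.1 : Module.End ℚ V₁) ∘ₗ π₁.toLinearMap +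
          ι₂.toLinearMap ∘ₗ (Y.2 : Module.End ℚ V₂) ∘ₗ π₂.toLinearMap, (hiff _).2 ⟨_, Y.1.2, _, Y.2.2, rfl⟩⟩
      map_add' := fun Y Z => Subtype.ext (by
        simp only [Prod.fst_add, Prod.snd_add, Submodule.coe_add, LinearMap.comp_add, LinearMap.add_comp]
        abel)
      map_smul' := fun c Y => Subtype.ext (by
        simp only [Prod.smul_fst, Prod.smul_snd, Submodule.coe_smul, LinearMap.comp_smul, LinearMap.smul_comp,
          RingHom.id_apply, smul_add]) }
  have hΦ : ∀ Y : H₁.hodgeLie × H₂.hodgeLie, ((Φ Y : H.hodgeLie) : Module.End ℚ V) =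
      ι₁.toLinearMap ∘ₗ (Y.1 : Module.End ℚ V₁) ∘ₗ π₁.toLinearMap +
        ι₂.toLinearMap ∘ₗ (Y.2 : Module.End ℚ V₂) ∘ₗ π₂.toLinearMap := fun _ => rfl
  have hb₁ : ∀ (Y₁ : Module.End ℚ V₁) (Y₂ : Module.End ℚ V₂),
      π₁.toLinearMap ∘ₗ (ι₁.toLinearMap ∘ₗ Y₁ ∘ₗ π₁.toLinearMap + ι₂.toLinearMap ∘ₗ Y₂ ∘ₗ π₂.toLinearMap) ∘ₗ
        ι₁.toLinearMap = Y₁ := fun Y₁ Y₂ => by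
    refine LinearMap.ext fun v => ?_
    simp only [LinearMap.comp_apply, LinearMap.add_apply, hπι₁,
      proj₂_incl₁_eq_zero'' ι₁ π₁ ι₂ π₂ hπι₁ hπι₂ hsum, map_zero, add_zero]
  have hb₂ : ∀ (Y₁ : Module.End ℚ V₁) (Y₂ : Module.End ℚ V₂),
      π₂.toLinearMap ∘ₗ (ι₁.toLinearMap ∘ₗ Y₁ ∘ₗ π₁.toLinearMap + ι₂.toLinearMap ∘ₗ Y₂ ∘ₗ π₂.toLinearMap) ∘ₗ
        ι₂.toLinearMap = Y₂ := fun Y₁ Y₂ => by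
    refine LinearMap.ext fun v => ?_
    simp only [LinearMap.comp_apply, LinearMap.add_apply, hπι₂, map_zero,
      proj₁_incl₂_eq_zero'' ι₁ π₁ ι₂ π₂ hπι₁ hπι₂ hsum, zero_add]
  have hinj : Function.Injective Φ := fun Y Z hYZ => by
    have h := congrArg (fun W : H.hodgeLie => (W : Module.End ℚ V)) hYZ
    simp only [hΦ] at h
    refine Prod.ext (Subtype.ext ?_) (Subtype.ext ?_)
    · rw [← hb₁ (Y.1 : Module.End ℚ V₁) (Y.2 : Module.End ℚ V₂), h, hb₁]
    · rw [← hb₂ (Y.1 : Module.End ℚ V₁) (Y.2 : Module.End ℚ V₂), h, hb₂]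
  have hsurj : Function.Surjective Φ := fun W => by
    obtain ⟨Y₁, hY₁, Y₂, hY₂, hW⟩ := (hiff _).1 W.2
    exact ⟨(⟨Y₁, hY₁⟩, ⟨Y₂, hY₂⟩), Subtype.ext (by rw [hΦ]; exact hW.symm)⟩
  exact ⟨LinearEquiv.ofBijective Φ ⟨hinj, hsurj⟩, fun Y => hΦ Y⟩

include hπι₁ hπι₂ hsum hcorner in
/-- `dim_ℚ 𝔥(H) = dim_ℚ 𝔥(H₁) + dim_ℚ 𝔥(H₂)` when `𝔥(H)` contains the first corners of its elements.
[cite: MoonenZarhin1999LowDim, §3 (3.1) and Lemma (3.4)] -/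
private theorem finrank_hodgeLie_eq_add_of_corner_mem :
    Module.finrank ℚ H.hodgeLie = Module.finrank ℚ H₁.hodgeLie + Module.finrank ℚ H₂.hodgeLie := by
  obtain ⟨Φ, -⟩ := exists_linearEquiv_prod_hodgeLie_of_corner_mem ι₁ π₁ ι₂ π₂ hπι₁ hπι₂ hsum hcorner
  rw [← Φ.finrank_eq, Module.finrank_prod]

end Corner

/-! ## §2 Glued `𝔰𝔩₂`-blocks on the second summand: Moonen–Zarhin Lemma (3.4) for `𝔥(H)` -/

include hπι₁ hπι₂ hsum in
/-- **Moonen–Zarhin Lemma (3.4) for `𝔥(H)`, glued `𝔰𝔩₂`-blocks summand:** for `H ≅ H₁ ⊕ H₂` of effective weight-one polarizable Hodge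
structures, `V₂ ⊗ ℂ = ⊕_k T_k` carrying Hodge-adapted two-dimensional blocks with (GLUED) every admissible rational `𝔤₂ ⊆ End(V₂)` glued
`𝔰𝔩₂`-blocks along `cls`, (BLOCKS) `End_Hdg(H₂)`-commuting rational operators preserving the blocks, (QS) non-zero rational `ψ₂`-skew
such operators non-zero on every block, and `Hom_Hdg(H₂, H₁) = 0`: (1) `𝔥(H)` CONTAINS THE FIRST CORNER `ι₁ (π₁ X ι₁) π₁` of each
`X ∈ 𝔥(H)` — the tree's `goursat_incl_corner_mem_of_hom_eq_zero_of_glued` for `𝔞 = 𝔥(H)` (bracket-closed, commuting with the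
projectors `ι_i π_i ∈ End_Hdg(H)`, `ψ_i`-skew corners in `𝔥(H_i)`, the second commuting with `End_Hdg(H₂)`, `Θ_H ∈ 𝔥(H)_ℂ`) — and hence
(2) **`dim_ℚ 𝔥(H) = dim_ℚ 𝔥(H₁) + dim_ℚ 𝔥(H₂)`** («`Hg(X₁ × X₂) = Hg(X₁) × Hg(X₂)`», §1).  No hypothesis on `H₁`.
[cite: MoonenZarhin1999LowDim, §2 (2.2) and §3 Lemma (3.4)] [cite: Hazama1983, §3 (pp. 305–306)] [cite: Murty1988, Thm. 2 (p. 67)]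
[cite: Deligne1982HodgeCycles, I §3.1 and Prop. 3.4] -/
theorem corner_mem_and_finrank_hodgeLie_eq_add_of_gluedBlocks_summand (hn : n = 1) (heff₁ : H₁.IsEffective)
    (heff₂ : H₂.IsEffective) (ψ₁ : H₁.Polarization) (ψ₂ : H₂.Polarization)
    {Θ₂ : Module.End ℂ (ℂ ⊗[ℚ] V₂)} (hΘ₂ : ∀ p, ∀ x ∈ H₂.piece p (n - p), Θ₂ x = ((2 * p - n : ℤ) : ℂ) • x)
    {κ : Type*} [Fintype κ] [DecidableEq κ] [Nonempty κ] {T : κ → Submodule ℂ (ℂ ⊗[ℚ] V₂)}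
    (hint : DirectSum.IsInternal T) (b₂ : ∀ k, Module.Basis (Fin 2) ℂ (T k))
    (hb0 : ∀ k, (b₂ k 0 : ℂ ⊗[ℚ] V₂) ∈ H₂.piece 1 (n - 1)) (hb1 : ∀ k, (b₂ k 1 : ℂ ⊗[ℚ] V₂) ∈ H₂.piece 0 (n - 0))
    (cls : κ → κ) (hcls : ∀ k, cls (cls k) = cls k)
    (hTE : ∀ X : Module.End ℚ V₂, (∀ a : H₂.endAlg, X * (a : Module.End ℚ V₂) = (a : Module.End ℚ V₂) * X) →
      ∀ k, Set.MapsTo (X.baseChange ℂ) (T k) (T k))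
    (hglued : ∀ 𝔤₂ : Submodule ℚ (Module.End ℚ V₂), (∀ X ∈ 𝔤₂, ∀ X' ∈ 𝔤₂, X * X' - X' * X ∈ 𝔤₂) →
      Θ₂ ∈ spanC 𝔤₂ → (∀ X ∈ 𝔤₂, ∀ a : H₂.endAlg, X * (a : Module.End ℚ V₂) = (a : Module.End ℚ V₂) * X) →
      (∀ X ∈ 𝔤₂, ∀ v w, ψ₂.form (X v) w + ψ₂.form v (X w) = 0) →
      (∀ Y ∈ spanC 𝔤₂, ∀ k, (blockMat hint b₂ Y k).trace = 0) ∧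
      (∀ Y ∈ spanC 𝔤₂, ∀ k k', cls k = cls k' → blockMat hint b₂ Y k = blockMat hint b₂ Y k') ∧
      (∀ (k₀ : κ) (N : Matrix (Fin 2) (Fin 2) ℂ), N.trace = 0 →
        assemble hint b₂ (fun k => if cls k = cls k₀ then N else 0) ∈ spanC 𝔤₂))
    (hqs : ∀ X : Module.End ℚ V₂, (∀ a : H₂.endAlg, X * (a : Module.End ℚ V₂) = (a : Module.End ℚ V₂) * X) →
      (∀ v w, ψ₂.form (X v) w + ψ₂.form v (X w) = 0) → X ≠ 0 → ∀ k, ∃ x ∈ T k, X.baseChange ℂ x ≠ 0)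
    (hHom : ∀ f : V₂ →ₗ[ℚ] V₁, (∀ p, ∀ x ∈ H₂.piece p (n - p), f.baseChange ℂ x ∈ H₁.piece p (n - p)) → f = 0) :
    (∀ X ∈ H.hodgeLie, ι₁.toLinearMap ∘ₗ (π₁.toLinearMap ∘ₗ X ∘ₗ ι₁.toLinearMap) ∘ₗ π₁.toLinearMap ∈ H.hodgeLie) ∧
      Module.finrank ℚ H.hodgeLie = Module.finrank ℚ H₁.hodgeLie + Module.finrank ℚ H₂.hodgeLie := by
  classical
  -- the presentation as linear-map identities
  have hπι₁' : π₁.toLinearMap ∘ₗ ι₁.toLinearMap = LinearMap.id := LinearMap.ext hπι₁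
  have hπι₂' : π₂.toLinearMap ∘ₗ ι₂.toLinearMap = LinearMap.id := LinearMap.ext hπι₂
  have hπ₁ι₂ : π₁.toLinearMap ∘ₗ ι₂.toLinearMap = 0 := LinearMap.ext (proj₁_incl₂_eq_zero'' ι₁ π₁ ι₂ π₂ hπι₁ hπι₂ hsum)
  have hπ₂ι₁ : π₂.toLinearMap ∘ₗ ι₁.toLinearMap = 0 := LinearMap.ext (proj₂_incl₁_eq_zero'' ι₁ π₁ ι₂ π₂ hπι₁ hπι₂ hsum)
  have hsum' : ι₁.toLinearMap ∘ₗ π₁.toLinearMap + ι₂.toLinearMap ∘ₗ π₂.toLinearMap = LinearMap.id := LinearMap.ext hsum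
  -- Hodge pieces and Hodge operators
  have hι₁F : ∀ p, ∀ x ∈ H₁.piece p (n - p), ι₁.toLinearMap.baseChange ℂ x ∈ H.piece p (n - p) :=
    fun p x hx => ι₁.map_piece_le p _ ⟨x, hx, rfl⟩
  have hι₂F : ∀ p, ∀ x ∈ H₂.piece p (n - p), ι₂.toLinearMap.baseChange ℂ x ∈ H.piece p (n - p) :=
    fun p x hx => ι₂.map_piece_le p _ ⟨x, hx, rfl⟩
  obtain ⟨ΘU, hΘU⟩ := exists_hodgeTheta H
  obtain ⟨Θ₁, hΘ₁⟩ := exists_hodgeTheta H₁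
  have hΘ𝔞 : ΘU ∈ spanC H.hodgeLie := (hodgeLieC_eq_spanC H) ▸ H.mem_hodgeLieC_of_forall_piece hΘU
  have hΘι₁ := theta_incl_eq H H₁ hι₁F hΘU hΘ₁
  have hΘι₂ := theta_incl_eq H H₂ hι₂F hΘU hΘ₂
  -- `𝔥(H)`: bracket-closed, commutes with the projectors, skew corners, second corner commutes with `End_Hdg(H₂)`
  have hbr : ∀ X ∈ H.hodgeLie, ∀ X' ∈ H.hodgeLie, X * X' - X' * X ∈ H.hodgeLie := fun X hX X' hX' =>
    H.commutator_mem_hodgeLie hX hX'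
  have hP₁ : ∀ X ∈ H.hodgeLie, X * (ι₁.toLinearMap ∘ₗ π₁.toLinearMap) = (ι₁.toLinearMap ∘ₗ π₁.toLinearMap) * X :=
    fun X hX => commute_of_mem_hodgeLie H hX ⟨_, Hom.toLinearMap_mem_endAlg (ι₁.comp π₁)⟩
  have hP₂ : ∀ X ∈ H.hodgeLie, X * (ι₂.toLinearMap ∘ₗ π₂.toLinearMap) = (ι₂.toLinearMap ∘ₗ π₂.toLinearMap) * X :=
    fun X hX => commute_of_mem_hodgeLie H hX ⟨_, Hom.toLinearMap_mem_endAlg (ι₂.comp π₂)⟩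
  have hskew₁ : ∀ X ∈ H.hodgeLie, ∀ v w, ψ₁.form ((π₁.toLinearMap ∘ₗ X ∘ₗ ι₁.toLinearMap) v) w +
      ψ₁.form v ((π₁.toLinearMap ∘ₗ X ∘ₗ ι₁.toLinearMap) w) = 0 :=
    fun X hX => form_apply_add_eq_zero_of_mem_hodgeLie ψ₁ (comp_mem_hodgeLie_of_retract ι₁ π₁ hπι₁ hX)
  have hskew₂ : ∀ X ∈ H.hodgeLie, ∀ v w, ψ₂.form ((π₂.toLinearMap ∘ₗ X ∘ₗ ι₂.toLinearMap) v) w +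
      ψ₂.form v ((π₂.toLinearMap ∘ₗ X ∘ₗ ι₂.toLinearMap) w) = 0 :=
    fun X hX => form_apply_add_eq_zero_of_mem_hodgeLie ψ₂ (comp_mem_hodgeLie_of_retract ι₂ π₂ hπι₂ hX)
  have hcomm₂ : ∀ X ∈ H.hodgeLie, ∀ a : H₂.endAlg,
      (π₂.toLinearMap ∘ₗ X ∘ₗ ι₂.toLinearMap) * (a : Module.End ℚ V₂) =
        (a : Module.End ℚ V₂) * (π₂.toLinearMap ∘ₗ X ∘ₗ ι₂.toLinearMap) :=
    fun X hX a => commute_of_mem_hodgeLie H₂ (comp_mem_hodgeLie_of_retract ι₂ π₂ hπι₂ hX) a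
  -- `Hom_Hdg(H₂, H₁) = 0` in `Θ`-form
  have hHom' : ∀ f : V₂ →ₗ[ℚ] V₁, Θ₁ ∘ₗ f.baseChange ℂ = f.baseChange ℂ ∘ₗ Θ₂ → f = 0 := fun f hf =>
    eq_zero_of_theta_comp_eq_of_hom_eq_zero hn H₁ H₂ heff₁ heff₂ hΘ₁ hΘ₂ hHom hf
  have hcorner : ∀ X ∈ H.hodgeLie,
      ι₁.toLinearMap ∘ₗ (π₁.toLinearMap ∘ₗ X ∘ₗ ι₁.toLinearMap) ∘ₗ π₁.toLinearMap ∈ H.hodgeLie :=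
    goursat_incl_corner_mem_of_hom_eq_zero_of_glued hn H₁ H₂ heff₁ heff₂ hπι₁' hπι₂' hπ₁ι₂ hπ₂ι₁ hsum' H.hodgeLie hbr hP₁ hP₂
      ψ₁ ψ₂ hskew₁ hskew₂ hcomm₂ hΘ₁ hΘ₂ hint b₂ hb0 hb1 cls hcls hTE hglued hqs hΘ𝔞 hΘι₁ hΘι₂ hHom'
  exact ⟨hcorner, finrank_hodgeLie_eq_add_of_corner_mem ι₁ π₁ ι₂ π₂ hπι₁ hπι₂ hsum hcorner⟩

end HodgeStructure

end Literature.AlgebraicGeometry.Motives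

end
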